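import Literature.AlgebraicGeometry.AbelianSchemes.SymplecticLiftPairFrames
import Literature.AlgebraicGeometry.AbelianSchemes.SymplecticLiftOfIsogenyTower
import Literature.AlgebraicGeometry.AbelianSchemes.LevelStructureTwist
import Literature.AlgebraicGeometry.AbelianSchemes.AbelianSchemeOverRestrictPt
import Literature.NumberTheory.Adeles.IntegralAdelesInverseLimit
import Literature.NumberTheory.Adeles.IntegralAdeleResidue
import HarnessLib

/-!
# Two symplectic lifts on one polarised fibre differ by an element of `K_δ(1) = GSp_δ(ẑ)`; at the level of the
# structures, `η₂(s) = (η₁ · γ̄_N)(s)` ([Deligne 1971] 4.12 (b); [Milne 2005] (63), §6 p. 75; [Lan 2013] Lemma 1.3.6.5)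

Topic `AlgebraicGeometry/AbelianSchemes`; namespace
`Literature.AlgebraicGeometry.AbelianSchemes.AbelianSchemeOver.LevelStructure.SymplecticLift`.  THEOREMS ONLY (no
definition, no named fact, no instance, no notation, no `sorry`; net Literature debt 0).  Cell hodgecm-mathlib (D-0151),
F-DAG leaf F-10 (b) «`classify` for the quotient `M/Γ`», brick (b1′) FILE 2 of 2 (HEAD), over FILE 1 ★
`SymplecticLiftPairFrames` (the compatible tower `(G_M, n_M)` between two lifts, as integer frames) and ★
`IntegralAdelesInverseLimit` (`GSp_δ(ẑ) = lim GSp_δ(ℤ/M)`: `exists_mem_principalLevelSubgroup_one_of_compatible`).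
PURPOSE (brick (b2) of F-10 (b)): on the kernel pair of a refining cover two symplectic-liftable level-`NK` structures
on the same polarised abelian scheme differ, pointwise, by the twist by `γ̄ ∈ GL_{2g}(ℤ/NK)` for a `γ ∈ K_δ(1)` — the
currency of ★ `isSymplecticLiftable_twist_of_mem_principalLevelSubgroup_one` / ★
`SiegelFineModuliScheme.exists_principalLevelSubgroup_one_action` (the operator `T_γ̄` on `A_{g,δ,NK}`), so that the two
classifying maps agree after `A_{g,δ,NK} → A_{g,δ,NK}/K`.  HC_CM is proved only modulo the 7 printed citations until
rung 0 closes; this file discharges none of them (count-neutral capital).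

SETTING as in FILE 1: `Λ₁ : η₁.SymplecticLift s Θ δ`, `Λ₂ : η₂.SymplecticLift s Θ δ` at one point `s : Spec Ω → S`
(`Ω` any field; it has characteristic `0` as soon as `N ≠ 0`, ★ `SymplecticLift.natCast_ne_zero`), same `Θ`, same `δ`.

* §1 **`exists_mem_principalLevelSubgroup_one_lift_eq`** — there is `γ ∈ K_δ(1)` whose reductions `γ̄_M` (entries
  `integralAdeleResidue M`) carry the whole tower: `Λ₂.lift_M x = Λ₁.lift_M (γ̄_M x)` for all `N ∣ M ≠ 0`;
  **`exists_mem_principalLevelSubgroup_one_restrict_σ_eq_twist`** — hence `η₂.σᵢ(s) = (η₁ · γ̄_N).σᵢ(s)`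
  (`restrict` currency of ★ `LevelStructureTwistLocallyConstant`, twist ★ `LevelStructure.twist`; the level-`N` layer
  is read by ★ `SymplecticLiftOfIsogenyTower.coe_lift_ofAdd_eq_restrictPt_section`).

Mathlib searched (pin): `charZero_of_inj_zero`, `Matrix.mulVec_single_one` (used).

## References
* P. Deligne, *Travaux de Shimura*, Sém. Bourbaki 389 (1971), 4.12 (b) pp. 148–149. [Deligne1971TravauxShimura]
* J. S. Milne, *Introduction to Shimura Varieties* (2005), §6 Thm. 6.11 p. 74 and p. 75. [Milne2005ShimuraVarieties]
* K.-W. Lan, *Arithmetic compactifications of PEL-type Shimura varieties* (2013), §1.3.6 Lemma 1.3.6.5 (p. 81).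
  [Lan2013PELCompactifications]
* D. Mumford, J. Fogarty, F. Kirwan, *Geometric Invariant Theory*, 3rd ed. (1994), Ch. 7 §1 Definition 7.1 (p. 129), §3
  (p. 139). [MumfordFogartyKirwan1994]
-/

noncomputable section

universe u

open CategoryTheory Limits AlgebraicGeometry MonoidalCategory NumberField IsDedekindDomain
open scoped MonObj Matrix

namespace Literature.AlgebraicGeometry.AbelianSchemes.AbelianSchemeOver.LevelStructure.SymplecticLift

open Literature.AlgebraicGeometry.Motives Literature.AlgebraicGeometry.ModuliOfAbelianVarieties
open Literature.NumberTheory.Adeles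

variable {S : Scheme.{u}} {A : AbelianSchemeOver S} {g N : ℕ} {Ω : Type u} [Field Ω] {s : Spec (.of Ω) ⟶ S}
  {Θ : CartierDivisor (A.fibre s).toAbelianVariety.X.left} {δ : Fin g → ℕ}

/-! ### §1 The element of `K_δ(1) = GSp_δ(ẑ)` and the twist at the level `N` -/

variable {η₁ η₂ : LevelStructure g N A} (Λ₁ : η₁.SymplecticLift s Θ δ) (Λ₂ : η₂.SymplecticLift s Θ δ)

/-- **TWO SYMPLECTIC LIFTS ON THE SAME POLARISED FIBRE DIFFER BY AN ELEMENT OF `K_δ(1) = GSp_δ(ẑ)`**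
([Deligne1971TravauxShimura] 4.12 (b): the symplectic `k : T̂(B) ⥲ V_ẑ` form ONE `K`-orbit; [Milne2005ShimuraVarieties]
(63): `η′ = η ∘ g`, `g ∈ K`; [Lan2013PELCompactifications] Lemma 1.3.6.5: the lifts `α̂` are unique up to
`G(ẑ)`).  For two symplectic lifts `Λ₁, Λ₂` of level-`N` structures `η₁, η₂` at the same geometric point `s`, for the
same witness divisor `Θ` and type `δ`, there is `γ ∈ K_δ(1)` whose reduction `γ̄_M` (entries through
`integralAdeleResidue M`) carries the whole tower: `Λ₂.lift_M x = Λ₁.lift_M (γ̄_M x)` at every level `N ∣ M` (`N ≠ 0`,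
so `Ω` has characteristic `0` by ★ `natCast_ne_zero`).  Proof: FILE 1 §3 (`exists_frames_multipliers`) + ★
`exists_mem_principalLevelSubgroup_one_of_compatible` (`γ ≡ A_M (mod M·ẑ)` along the tower).
[cite: Deligne1971TravauxShimura, 4.12 (b) pp. 148–149] [cite: Milne2005ShimuraVarieties, §6 Thm. 6.11 p. 74 and p. 75]
[cite: Lan2013PELCompactifications, §1.3.6 Lemma 1.3.6.5 (p. 81)] -/
theorem exists_mem_principalLevelSubgroup_one_lift_eq (hN : N ≠ 0) :
    ∃ r : gspFinAdelic δ, r ∈ principalLevelSubgroup δ 1 ∧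
      ∀ (M : ℕ) [NeZero M], N ∣ M → ∀ GM : Matrix (Fin g ⊕ Fin g) (Fin g ⊕ Fin g) (ZMod M),
        (∀ (i j : Fin g ⊕ Fin g)
          (h : ((r : GL (Fin g ⊕ Fin g) finAdeleQ) : Matrix (Fin g ⊕ Fin g) (Fin g ⊕ Fin g) finAdeleQ) i j ∈
            FiniteAdeleRing.integralAdeles (𝓞 ℚ) ℚ), GM i j = integralAdeleResidue M ⟨_, h⟩) →
        ∀ x : Fin g ⊕ Fin g → ZMod M,
          Λ₂.lift M (Multiplicative.ofAdd x) = Λ₁.lift M (Multiplicative.ofAdd (GM *ᵥ x)) := by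
  -- a point carrying a symplectic lift has residue characteristic `0`
  haveI : CharZero Ω := charZero_of_inj_zero fun M hM => by_contra fun hM0 => Λ₁.natCast_ne_zero hN hM0 hM
  obtain ⟨A, B, n, n', hA, hB, hAB, hBA, hn, hn', hnn', hsymp, hread⟩ := exists_frames_multipliers Λ₁ Λ₂
  obtain ⟨r, ν, hr1, -, -, -, hrA, -⟩ :=
    exists_mem_principalLevelSubgroup_one_of_compatible δ hN A B n n' hA hB hAB hBA hn hn' hnn' hsymp
  refine ⟨r, hr1, fun M _ hNM GM hGM x => ?_⟩
  have hGA : GM = (A M).map (Int.castRingHom (ZMod M)) := by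
    ext i j
    rw [hGM i j (isIntegral_of_isCongOne_one ((mem_principalLevelSubgroup_iff δ).1 hr1).1 i j), Matrix.map_apply,
      eq_intCast]
    exact integralAdeleResidue_clause M _ (A M i j) (hrA M (NeZero.ne M) hNM i j)
  rw [hGA]
  exact hread hNM (NeZero.ne M) x

include Λ₁ Λ₂ in
/-- **TWO SYMPLECTIC-LIFTABLE LEVEL STRUCTURES ON THE SAME POLARISED FIBRE DIFFER, AT THE POINT, BY THE TWIST BY AN
ELEMENT OF `K_δ(1)`**: with `γ ∈ K_δ(1)` of `exists_mem_principalLevelSubgroup_one_lift_eq` and `γ̄_N ∈ GL_{2g}(ℤ/N)` its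
reduction (entries `integralAdeleResidue N`, the currency of ★ `isSymplecticLiftable_twist_of_mem_principalLevelSubgroup_one`),
`η₂(s) = (η₁ · γ̄_N)(s)`: `restrict s (η₂.σ i) = restrict s ((η₁.twist γ̄_N).σ i)` for every `i` — read the level `N`
layer of the tower through `lift_level`. [cite: Deligne1971TravauxShimura, 4.12 (b) p. 149]
[cite: Milne2005ShimuraVarieties, §6 p. 75] [cite: MumfordFogartyKirwan1994, Ch. 7 §3 (p. 139)] -/
theorem exists_mem_principalLevelSubgroup_one_restrict_σ_eq_twist [NeZero N] [IsCommMonObj A.X] :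
    ∃ r : gspFinAdelic δ, r ∈ principalLevelSubgroup δ 1 ∧
      ∀ GN : GL (Fin g ⊕ Fin g) (ZMod N),
        (∀ (i j : Fin g ⊕ Fin g)
          (h : ((r : GL (Fin g ⊕ Fin g) finAdeleQ) : Matrix (Fin g ⊕ Fin g) (Fin g ⊕ Fin g) finAdeleQ) i j ∈
            FiniteAdeleRing.integralAdeles (𝓞 ℚ) ℚ),
          (GN : Matrix (Fin g ⊕ Fin g) (Fin g ⊕ Fin g) (ZMod N)) i j = integralAdeleResidue N ⟨_, h⟩) →
        ∀ i, A.restrict s (η₂.σ i) = A.restrict s ((η₁.twist GN).σ i) := by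
  obtain ⟨r, hr1, hread⟩ := exists_mem_principalLevelSubgroup_one_lift_eq Λ₁ Λ₂ (NeZero.ne N)
  refine ⟨r, hr1, fun GN hGN i => ?_⟩
  rw [← AbelianSchemeOver.restrictPt_eq_restrictPt_iff]
  have h := congrArg Subtype.val
    (hread N dvd_rfl (GN : Matrix (Fin g ⊕ Fin g) (Fin g ⊕ Fin g) (ZMod N)) hGN (Pi.single i 1))
  have e₁ : ((Λ₁.lift N (Multiplicative.ofAdd
      ((GN : Matrix (Fin g ⊕ Fin g) (Fin g ⊕ Fin g) (ZMod N)) *ᵥ Pi.single i 1))) :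
        (A.fibre s).toAbelianVariety.Points Ω) = A.restrictPt s ((η₁.twist GN).σ i) := by
    rw [coe_lift_ofAdd_eq_restrictPt_section, ← LevelStructure.section_twist, LevelStructure.section_,
      LevelStructure.sectionPow_single (η₁.twist GN).pow_σ]
  rw [← Λ₂.lift_level i, ← e₁]
  exact h

end Literature.AlgebraicGeometry.AbelianSchemes.AbelianSchemeOver.LevelStructure.SymplecticLift

end
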